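import Mathlib
import Summits.MatrixMultiplication.MatrixMultiplication.Theorems.SubgroupIdentityDesigns.Negative.LevelOneCornerSlice

/-!
# Level `k` sandwich triples: the corner-`1` slice of `H₁H₂H₃` is `U⁻U⁺`
(negative-lemma support for the crux `SubgroupIdentityDesigns`, stmt-MatrixMultiplication-14079; line
`ghost-calculus-chebotarev`, stub `stub_levelKCornerSlice`; the general-level version of
`Negative.LevelOneCornerSlice`)

In `G = GL_m(𝔽_p)` with `3k ≤ m`, let `U⁻ = {[[1,0],[X,1]]}` (blocks along `Fin k ⊕ Fin (m - k)`; `u - 1`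
supported in rows `≥ k`, columns `< k`) and `U⁺ = {[[1,Z],[0,1]]}` (`v - 1` supported in rows `< k`, columns
`≥ k`).  Suppose `U⁻ ≤ H₁`, `U⁺ ≤ H₃` and the triple `(H₁, H₂, H₃)` passes the level-`k` identity test of the
crux (a Fourier table `c` supported in rank `≤ k` with `f_c(1) = 1` and `f_c(abg) = 0` for `abg ≠ 1`).  Then
every product `x = abg` whose top-left `k × k` block is the identity factors as `u v`, `u ∈ U⁻`, `v ∈ U⁺`
(`stub_levelKCornerSlice`).

Proof (verbatim the level-`1` argument with `Fin 1 ⊕ Fin n` replaced by `Fin k ⊕ Fin (m - k)`): write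
`x = [[1, r],[c, B]] = g(c, D, r)` with the Schur complement `D = B - c r` (`g(X,s,Z) = [[1,Z],[X,XZ+s]] =
blockPt X s Z` of `Negative.LeviCollision`, `eq_blockPt_of_toBlocks₁₁`).  If `D = 1` then
`x = g(c,1,0) · g(0,1,r) ∈ U⁻U⁺`.  If `D ≠ 1`: `g(X - c, 1, 0) · x · g(0, 1, Z - r) = g(X, D, Z)` and
`g(X,1,0) · 1 · g(0,1,Z) = g(X,1,Z)` lie in `H₁H₂H₃`, a collision pair `γ (D - 1) β = 0` exists since
`2k ≤ m - k` (`exists_leviCollision_pair`), and `no_idTest_of_leviCollision` (transported along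
`Fin k ⊕ Fin (m - k) ≃ Fin m`) refutes the identity test.  The degenerate levels `k = 0` (then the slice
condition is empty, `D = x`, and the identity test forces `H₁H₂H₃ = 1`) are covered by the same argument.
-/

set_option linter.dupNamespace false

noncomputable section

open scoped BigOperators
open Matrix

namespace Summit.MatrixMultiplication.MatrixMultiplication.Theorems.SubgroupIdentityDesigns.Negative

namespace LevelKCornerSlice

open Summit.MatrixMultiplication.MatrixMultiplication.Theorems.LieRankDesigns.Negative (GLm Mat)
open LevelOneCornerSlice

section Unipotents

variable {p : ℕ} {k r m : ℕ}

/-- `e(g(X, 1, 0)) = e([[1,0],[X,1]])` satisfies the LOWER support predicate (`u - 1` lives in rows `≥ k`,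
columns `< k`) whenever `e` sends `inl` into `{0, …, k-1}` and `inr` into `{k, …, m-1}`. -/
theorem lower_of_val_eq (e : Fin k ⊕ Fin r ≃ Fin m) (he₀ : ∀ j : Fin k, (e (Sum.inl j)).val < k)
    (he₁ : ∀ i : Fin r, k ≤ (e (Sum.inr i)).val) (X : Matrix (Fin r) (Fin k) (ZMod p)) {u : GLm p m}
    (hu : (u : Mat p m) = Matrix.reindex e e (blockPt X 1 0)) :
    ∀ i j : Fin m, ((u : Mat p m) - 1) i j ≠ 0 → k ≤ i.val ∧ j.val < k := by
  intro i j hij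
  obtain ⟨i', rfl⟩ := e.surjective i
  obtain ⟨j', rfl⟩ := e.surjective j
  rw [hu, reindex_sub_one_apply] at hij
  rcases i' with i' | i' <;> rcases j' with j' | j'
  · simp [blockPt, Matrix.one_apply] at hij
  · simp [blockPt] at hij
  · exact ⟨he₁ i', he₀ j'⟩
  · simp [blockPt, Matrix.one_apply] at hij

/-- `e(g(0, 1, Z)) = e([[1,Z],[0,1]])` satisfies the UPPER support predicate (`v - 1` lives in rows `< k`,
columns `≥ k`). -/
theorem upper_of_val_eq (e : Fin k ⊕ Fin r ≃ Fin m) (he₀ : ∀ j : Fin k, (e (Sum.inl j)).val < k)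
    (he₁ : ∀ i : Fin r, k ≤ (e (Sum.inr i)).val) (Z : Matrix (Fin k) (Fin r) (ZMod p)) {v : GLm p m}
    (hv : (v : Mat p m) = Matrix.reindex e e (blockPt 0 1 Z)) :
    ∀ i j : Fin m, ((v : Mat p m) - 1) i j ≠ 0 → i.val < k ∧ k ≤ j.val := by
  intro i j hij
  obtain ⟨i', rfl⟩ := e.surjective i
  obtain ⟨j', rfl⟩ := e.surjective j
  rw [hv, reindex_sub_one_apply] at hij
  rcases i' with i' | i' <;> rcases j' with j' | j'
  · simp [blockPt, Matrix.one_apply] at hij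
  · exact ⟨he₀ i', he₁ j'⟩
  · simp [blockPt] at hij
  · simp [blockPt, Matrix.one_apply] at hij

variable [Fact p.Prime]

/-- If `x ∈ GL_m(𝔽_p)` has transported block form `g(X, 1, Z)` (Schur complement `1`) then
`x = e(g(X,1,0)) · e(g(0,1,Z)) ∈ U⁻U⁺`. -/
theorem exists_lower_mul_upper (e : Fin k ⊕ Fin r ≃ Fin m) (he₀ : ∀ j : Fin k, (e (Sum.inl j)).val < k)
    (he₁ : ∀ i : Fin r, k ≤ (e (Sum.inr i)).val) (X : Matrix (Fin r) (Fin k) (ZMod p))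
    (Z : Matrix (Fin k) (Fin r) (ZMod p)) {x : GLm p m}
    (hx : (x : Mat p m) = Matrix.reindex e e (blockPt X 1 Z)) :
    ∃ u v : GLm p m,
      (∀ i j : Fin m, ((u : Mat p m) - 1) i j ≠ 0 → k ≤ i.val ∧ j.val < k) ∧
      (∀ i j : Fin m, ((v : Mat p m) - 1) i j ≠ 0 → i.val < k ∧ k ≤ j.val) ∧ x = u * v := by
  obtain ⟨u, hu⟩ := exists_gl_val_eq e (blockPt X 1 (0 : Matrix (Fin k) (Fin r) (ZMod p)))
    (by rw [det_blockPt, Matrix.det_one]; exact one_ne_zero)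
  obtain ⟨v, hv⟩ := exists_gl_val_eq e (blockPt (0 : Matrix (Fin r) (Fin k) (ZMod p)) 1 Z)
    (by rw [det_blockPt, Matrix.det_one]; exact one_ne_zero)
  refine ⟨u, v, lower_of_val_eq e he₀ he₁ X hu, upper_of_val_eq e he₀ he₁ Z hv, Units.ext ?_⟩
  rw [Units.val_mul, hu, hv, hx, reindex_mul_reindex, blockPt_one_zero_mul, add_zero]

/-- **Levi collision at level `k`.**  If `U⁻ ≤ H₁`, `U⁺ ≤ H₃`, the triple passes the level-`k` identity
test, and some product `abg` has transported block form `g(X₀, D, Z₀)` (blocks `Fin k ⊕ Fin r`, `2k ≤ r`)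
with `D ≠ 1`, contradiction: all `g(X, D, Z)` and `g(X, 1, Z)` lie in `H₁H₂H₃`, and a collision pair for
`D - 1` exists as `2k ≤ r`. -/
theorem false_of_idTest_of_schur_ne_one (hkr : 2 * k ≤ r) (e : Fin k ⊕ Fin r ≃ Fin m)
    (he₀ : ∀ j : Fin k, (e (Sum.inl j)).val < k) (he₁ : ∀ i : Fin r, k ≤ (e (Sum.inr i)).val)
    {H₁ H₂ H₃ : Subgroup (GLm p m)}
    (hU : ∀ u : GLm p m, (∀ i j : Fin m, ((u : Mat p m) - 1) i j ≠ 0 → k ≤ i.val ∧ j.val < k) → u ∈ H₁)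
    (hV : ∀ v : GLm p m, (∀ i j : Fin m, ((v : Mat p m) - 1) i j ≠ 0 → i.val < k ∧ k ≤ j.val) → v ∈ H₃)
    (c : Mat p m → ℂ) (hc : ∀ M, k < M.rank → c M = 0)
    (h1 : (∑ M : Mat p m, c M * ZMod.stdAddChar (Matrix.trace (M * ((1 : GLm p m) : Mat p m)))) = 1)
    (h0 : ∀ a ∈ H₁, ∀ b ∈ H₂, ∀ g ∈ H₃, a * b * g ≠ 1 →
      (∑ M : Mat p m, c M * ZMod.stdAddChar (Matrix.trace (M * ((a * b * g : GLm p m) : Mat p m)))) = 0)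
    {a b g : GLm p m} (ha : a ∈ H₁) (hb : b ∈ H₂) (hg : g ∈ H₃)
    (X₀ : Matrix (Fin r) (Fin k) (ZMod p)) (D : Matrix (Fin r) (Fin r) (ZMod p))
    (Z₀ : Matrix (Fin k) (Fin r) (ZMod p))
    (hx : ((a * b * g : GLm p m) : Mat p m) = Matrix.reindex e e (blockPt X₀ D Z₀)) (hD : D ≠ 1) :
    False := by
  obtain ⟨γ, β, γ', β', hγ, hβ, hcol⟩ := exists_leviCollision_pair (F := ZMod p) hkr (D - 1)
  have hdet : ∀ (X : Matrix (Fin r) (Fin k) (ZMod p)) (Z : Matrix (Fin k) (Fin r) (ZMod p)),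
      (blockPt X (1 : Matrix (Fin r) (Fin r) (ZMod p)) Z).det ≠ 0 := fun X Z => by
    rw [det_blockPt, Matrix.det_one]; exact one_ne_zero
  -- the transported product set `H₁H₂H₃`
  let S : Set (Matrix (Fin k ⊕ Fin r) (Fin k ⊕ Fin r) (ZMod p)) :=
    {s | ∃ a ∈ H₁, ∃ b ∈ H₂, ∃ g ∈ H₃, Matrix.reindex e e s = ((a * b * g : GLm p m) : Mat p m)}
  have hSt : ∀ (X : Matrix (Fin r) (Fin k) (ZMod p)) (Z : Matrix (Fin k) (Fin r) (ZMod p)),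
      blockPt X D Z ∈ S := by
    intro X Z
    obtain ⟨u, hu⟩ := exists_gl_val_eq e _ (hdet (X - X₀) 0)
    obtain ⟨v, hv⟩ := exists_gl_val_eq e _ (hdet 0 (Z - Z₀))
    refine ⟨u * a, H₁.mul_mem (hU u (lower_of_val_eq e he₀ he₁ _ hu)) ha, b, hb, g * v,
      H₃.mul_mem hg (hV v (upper_of_val_eq e he₀ he₁ _ hv)), ?_⟩
    have hassoc : u * a * b * (g * v) = u * (a * b * g) * v := by simp only [mul_assoc]
    rw [hassoc, Units.val_mul, Units.val_mul, hu, hx, hv, reindex_mul_reindex, reindex_mul_reindex,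
      blockPt_one_zero_mul, sub_add_cancel, blockPt_mul_zero_one, add_sub_cancel]
  have hS1 : ∀ (X : Matrix (Fin r) (Fin k) (ZMod p)) (Z : Matrix (Fin k) (Fin r) (ZMod p)),
      blockPt X 1 Z ∈ S := by
    intro X Z
    obtain ⟨u, hu⟩ := exists_gl_val_eq e _ (hdet X 0)
    obtain ⟨v, hv⟩ := exists_gl_val_eq e _ (hdet 0 Z)
    refine ⟨u, hU u (lower_of_val_eq e he₀ he₁ _ hu), 1, H₂.one_mem, v,
      hV v (upper_of_val_eq e he₀ he₁ _ hv), ?_⟩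
    rw [mul_one, Units.val_mul, hu, hv, reindex_mul_reindex, blockPt_one_zero_mul, add_zero]
  -- the transported coefficient table
  let c' : Matrix (Fin k ⊕ Fin r) (Fin k ⊕ Fin r) (ZMod p) → ℂ := fun M' => c (Matrix.reindex e e M')
  have hc' : ∀ M', Fintype.card (Fin k) < M'.rank → c' M' = 0 := by
    intro M' hM'
    apply hc
    rw [Matrix.rank_reindex]
    simpa using hM'
  have h1' : (∑ M' : Matrix (Fin k ⊕ Fin r) (Fin k ⊕ Fin r) (ZMod p),
      c' M' * ZMod.stdAddChar (Matrix.trace (M' * 1))) = 1 := by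
    have := LevelOneCornerSlice.fourier_reindex e c 1
    rw [Matrix.reindex_apply, Matrix.submatrix_one_equiv] at this
    rw [← this]
    rwa [Units.val_one] at h1
  have h0' : ∀ s ∈ S, s ≠ 1 → (∑ M' : Matrix (Fin k ⊕ Fin r) (Fin k ⊕ Fin r) (ZMod p),
      c' M' * ZMod.stdAddChar (Matrix.trace (M' * s))) = 0 := by
    rintro s ⟨a', ha', b', hb', g', hg', hs⟩ hs1
    have hne : a' * b' * g' ≠ 1 := by
      intro h
      apply hs1
      rw [h, Units.val_one] at hs
      have : s = (Matrix.reindex e e).symm 1 := by rw [← hs]; simp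
      rw [this, Matrix.reindex_symm, Matrix.reindex_apply, Matrix.submatrix_one_equiv]
    have h := h0 a' ha' b' hb' g' hg' hne
    rw [← hs, LevelOneCornerSlice.fourier_reindex] at h
    exact h
  exact no_idTest_of_leviCollision γ β γ' β' hγ hβ D hD hcol S hSt hS1 c' hc' h1' h0'

/-- **The corner-`1` slice of a level-`k` sandwich is `U⁻U⁺`** (named-hypothesis form of
`stub_levelKCornerSlice`). -/
theorem cornerSlice (hkm : 3 * k ≤ m) {H₁ H₂ H₃ : Subgroup (GLm p m)}
    (hU : ∀ u : GLm p m, (∀ i j : Fin m, ((u : Mat p m) - 1) i j ≠ 0 → k ≤ i.val ∧ j.val < k) → u ∈ H₁)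
    (hV : ∀ v : GLm p m, (∀ i j : Fin m, ((v : Mat p m) - 1) i j ≠ 0 → i.val < k ∧ k ≤ j.val) → v ∈ H₃)
    (hid : ∃ c : Mat p m → ℂ, (∀ M, k < M.rank → c M = 0) ∧
      (∑ M : Mat p m, c M * ZMod.stdAddChar (Matrix.trace (M * ((1 : GLm p m) : Mat p m)))) = 1 ∧
      ∀ a ∈ H₁, ∀ b ∈ H₂, ∀ g ∈ H₃, a * b * g ≠ 1 →
        (∑ M : Mat p m, c M * ZMod.stdAddChar (Matrix.trace (M * ((a * b * g : GLm p m) : Mat p m)))) = 0)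
    {a b g : GLm p m} (ha : a ∈ H₁) (hb : b ∈ H₂) (hg : g ∈ H₃)
    (hcorner : ∀ i j : Fin m, i.val < k → j.val < k → (((a * b * g : GLm p m) : Mat p m) - 1) i j = 0) :
    ∃ u v : GLm p m,
      (∀ i j : Fin m, ((u : Mat p m) - 1) i j ≠ 0 → k ≤ i.val ∧ j.val < k) ∧
      (∀ i j : Fin m, ((v : Mat p m) - 1) i j ≠ 0 → i.val < k ∧ k ≤ j.val) ∧
      a * b * g = u * v := by
  obtain ⟨c, hc, h1, h0⟩ := hid
  -- coordinates `Fin k ⊕ Fin (m - k) ≃ Fin m`, `inl j ↦ j`, `inr i ↦ k + i`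
  have hkm' : k + (m - k) = m := by omega
  set e : Fin k ⊕ Fin (m - k) ≃ Fin m := finSumFinEquiv.trans (finCongr hkm') with he
  have he₀ : ∀ j : Fin k, (e (Sum.inl j)).val < k := fun j => by simp [he]
  have he₁ : ∀ i : Fin (m - k), k ≤ (e (Sum.inr i)).val := fun i => by simp [he]
  -- block form of `x = abg`: corner block `1`, hence `x = e(g(c, D, r))` with the Schur complement `D`
  set x' : Matrix (Fin k ⊕ Fin (m - k)) (Fin k ⊕ Fin (m - k)) (ZMod p) :=
    (Matrix.reindex e e).symm ((a * b * g : GLm p m) : Mat p m) with hx'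
  have hx : ((a * b * g : GLm p m) : Mat p m) = Matrix.reindex e e x' :=
    ((Matrix.reindex e e).apply_symm_apply _).symm
  have h11 : x'.toBlocks₁₁ = 1 := by
    ext i j
    have h := hcorner (e (Sum.inl i)) (e (Sum.inl j)) (he₀ i) (he₀ j)
    rw [hx, reindex_sub_one_apply, Matrix.sub_apply, sub_eq_zero] at h
    rw [Matrix.toBlocks₁₁, Matrix.of_apply, h]
    simp [Matrix.one_apply]
  have hxb := eq_blockPt_of_toBlocks₁₁ x' h11
  by_cases hD : x'.toBlocks₂₂ - x'.toBlocks₂₁ * x'.toBlocks₁₂ = 1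
  · rw [hD] at hxb
    rw [hxb] at hx
    exact exists_lower_mul_upper e he₀ he₁ _ _ hx
  · rw [hxb] at hx
    exact (false_of_idTest_of_schur_ne_one (by omega) e he₀ he₁ hU hV c hc h1 h0 ha hb hg _ _ _ hx
      hD).elim

end Unipotents

end LevelKCornerSlice

/-- **Stub `stub_levelKCornerSlice` (line `ghost-calculus-chebotarev`).**  For a level-`k` sandwich
`U⁻ ≤ H₁`, `U⁺ ≤ H₃` in `GL_m(𝔽_p)` (`3k ≤ m`) passing the level-`k` identity test, every product `abg`
(`a ∈ H₁`, `b ∈ H₂`, `g ∈ H₃`) whose top-left `k × k` block is the identity factors as `u v` with `u ∈ U⁻`,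
`v ∈ U⁺`. -/
theorem stub_levelKCornerSlice :
    ∀ (p : ℕ) [Fact p.Prime] (m k : ℕ), 3 * k ≤ m →
      ∀ (H₁ H₂ H₃ : Subgroup (Matrix.GeneralLinearGroup (Fin m) (ZMod p))),
      (∀ u : Matrix.GeneralLinearGroup (Fin m) (ZMod p),
        (∀ i j : Fin m, ((u : Matrix (Fin m) (Fin m) (ZMod p)) - 1) i j ≠ 0 → k ≤ i.val ∧ j.val < k) →
          u ∈ H₁) →
      (∀ v : Matrix.GeneralLinearGroup (Fin m) (ZMod p),
        (∀ i j : Fin m, ((v : Matrix (Fin m) (Fin m) (ZMod p)) - 1) i j ≠ 0 → i.val < k ∧ k ≤ j.val) →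
          v ∈ H₃) →
      (∃ c : Matrix (Fin m) (Fin m) (ZMod p) → ℂ, (∀ M, k < M.rank → c M = 0) ∧
        (∑ M : Matrix (Fin m) (Fin m) (ZMod p), c M * ZMod.stdAddChar (Matrix.trace
          (M * ((1 : Matrix.GeneralLinearGroup (Fin m) (ZMod p)) : Matrix (Fin m) (Fin m) (ZMod p))))) = 1 ∧
        ∀ a ∈ H₁, ∀ b ∈ H₂, ∀ g ∈ H₃, a * b * g ≠ 1 →
          (∑ M : Matrix (Fin m) (Fin m) (ZMod p), c M * ZMod.stdAddChar (Matrix.trace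
            (M * ((a * b * g : Matrix.GeneralLinearGroup (Fin m) (ZMod p)) :
              Matrix (Fin m) (Fin m) (ZMod p))))) = 0) →
      ∀ a ∈ H₁, ∀ b ∈ H₂, ∀ g ∈ H₃,
        (∀ i j : Fin m, i.val < k → j.val < k →
          (((a * b * g : Matrix.GeneralLinearGroup (Fin m) (ZMod p)) : Matrix (Fin m) (Fin m) (ZMod p)) - 1)
            i j = 0) →
        ∃ u v : Matrix.GeneralLinearGroup (Fin m) (ZMod p),
          (∀ i j : Fin m, ((u : Matrix (Fin m) (Fin m) (ZMod p)) - 1) i j ≠ 0 → k ≤ i.val ∧ j.val < k) ∧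
          (∀ i j : Fin m, ((v : Matrix (Fin m) (Fin m) (ZMod p)) - 1) i j ≠ 0 → i.val < k ∧ k ≤ j.val) ∧
          a * b * g = u * v :=
  fun _ _ _ _ hkm _ _ _ hU hV hid _ ha _ hb _ hg hcorner =>
    LevelKCornerSlice.cornerSlice hkm hU hV hid ha hb hg hcorner

end Summit.MatrixMultiplication.MatrixMultiplication.Theorems.SubgroupIdentityDesigns.Negative

end
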